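import Literature.Computability.AlgebraicComplexity.MatMulM22RankLowerBoundProofs
import HarnessLib

/-!
# Alekseev 2015, Lemma 7 at its printed strength, and the parameters of a length-`3m + 2` computation of `⟨m,2,2⟩`

Topic `Literature/Computability/AlgebraicComplexity` (bilinear complexity; small formats). Sibling of
`MatMulM22RankLowerBoundProofs.lean`, whose `Alekseev2015.Frame.stepD` is Alekseev's Lemma 7 run at
the parameters `(2m, m+1)` (all that Theorem 1 needs, and valid for every `m ≥ 3`). The source states
and proves Lemma 7 in the STRONGER form «Задача `P` при `m ≥ 5` не имеет решений с параметрами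
`(2m, m+2)`» ("для использования в будущем"), and uses it in §4 (Заключение, p. 24) for the smallest
open case: for `m = 5` the bilinear complexity is `17` or `18`, and «решение сложности 17 может
существовать только с параметрами (10,7), (11,6) или (12,5), что вытекает из леммы 6. Однако лемма 7
показывает, что первый случай невозможен.» This file formalises exactly that:

* `Frame.false_of_sameClass_two` — Lemma 11 at `(2m, ≤ m+2)`, `m ≥ 5`: two "type G" matrices `N_t`
  in one class of rows force the other `m` matrices `N_t` to have rank one (Lemma 8 + Lemma 10 +
  the span equality of Lemma 9/Lemma 5), and then the column count gives `2m ≤ m + 4`;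
* `Frame.stepD_two` — **Lemma 7 as printed**: no solution with parameters `(2m, m+2)`, `m ≥ 5`
  (the count of rank-one `N_t` gives `s ≤ 4`, a non-zero `Q = ∑ c_i P_i` in the span of the
  rank-two `N_t` exists since `m − s ≥ 1`, and it forces a rank-two `N_t` to have rank one);
* `Frame.two_mul_add_one_le_card_I` / `Frame.params_of_card_eq` — Lemma 6 + Lemma 7: a computation
  of length `≤ 3m + 2`, `m ≥ 5`, has `l ≥ 2m + 1`; of length exactly `3m + 2` it has parameters
  `(2m+1, m+1)` or `(2m+2, m)`;
* `params_522_of_length_17` — the §4 sentence: a length-17 computation of `⟨5,2,2⟩` (equivalently,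
  by transposition, of the census format `⟨2,2,5⟩`) over ANY field has frame parameters `(11,6)` or
  `(12,5)`.

Dictionary (as in the sibling file): for `xy = ∑_t f_t(x) g_t(y) w_t` (`x ∈ k^{m×2}`, `y ∈ k^{2×2}`),
`D_t^1 = f_t ⊗ p_t` with `p_t = g_t` restricted to the first column of `y`; a frame is a maximal
independent subfamily `(D_t^1)_{t ∈ I}`, `l = |I|`, `J = Iᶜ`. Nothing here changes any bound on the
rank; it is the printed normal-form restriction on the open cell `17 ≤ R(⟨2,2,5⟩) ≤ 18`.

## References

* V. B. Alekseev, *O bilineinoi slozhnosti umnozheniya matrits razmerov `m × 2` i `2 × 2`*,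
  Chebyshevskiĭ Sb. 16 (4) (2015) 11–27: Lemma 7 and Lemma 11 (pp. 18–21), §4 (p. 24).
  [Alekseev2015ChebyshevM22]
-/

namespace Literature.Computability.AlgebraicComplexity

open Module Matrix

namespace Alekseev2015

variable {k : Type*} [Field k] {m : ℕ} {ι : Type*} [Fintype ι]

namespace Frame

variable {β : BilinComp (mulBilin k m 2 2) ι} (F : Frame β) [DecidableEq ι]

section StepDTwo

variable (hI : F.I.card = 2 * m)

/-- Expansion in the dual basis: `x = ∑_j f_j(x) x_j`. [folklore] -/
private theorem expand₂ (x : Matrix (Fin m) (Fin 2) k) : x = ∑ j : ↥F.I, β.f j x • F.xd hI j := by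
  rw [← sub_eq_zero, ← Module.forall_dual_apply_eq_zero_iff k]
  intro φ
  rw [← (F.basisF hI).sum_repr φ]
  simp only [LinearMap.coe_sum, Finset.sum_apply]
  refine Finset.sum_eq_zero fun t _ => ?_
  rw [LinearMap.smul_apply, basisF_apply, map_sub, map_sum]
  simp only [map_smul, f_xd, smul_eq_mul, mul_ite, mul_one, mul_zero, Finset.sum_ite_eq,
    Finset.mem_univ, if_true, sub_self]

/-- A linear map is determined on the dual basis: values in a subspace. [folklore] -/
private theorem map_mem_of_xd_mem₂ (N : Blk k m) (P : Submodule k (Fin 2 → k))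
    (h : ∀ j : ↥F.I, N (F.xd hI j) ∈ P) (x : Matrix (Fin m) (Fin 2) k) : N x ∈ P := by
  rw [F.expand₂ hI x, map_sum]
  exact Submodule.sum_mem _ fun j _ => by rw [map_smul]; exact Submodule.smul_mem _ _ (h j)

include hI in
/-- **Lemma 11** (at parameters `(2m, ≤ m+2)`, `m ≥ 5`): two distinct indices `t₁ ≠ t₂` outside `I`
of "type G" (non-zero `p`) cannot belong to the same class of rows. The `m` independent matrices
`P_i`, restricted to the rows of the other classes (Lemma 9), lie in the span of the `|J| − 2 ≤ m`
restricted matrices `N_t`, `t ≠ t₁, t₂`; so these spans coincide, every such restricted `N_t` is a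
combination of the restricted `P_i`, hence (Lemma 8) has its values at `x_j` on the line `k p_j`,
while (Lemma 10) a type-G `N_t` is non-zero only on the class of `p_t` — so all `m` of them have rank
one, and the column count `2m ≤ s + 2(|J| − s)` gives `2m ≤ m + 4`, i.e. `m ≤ 4`.
[cite: Alekseev2015ChebyshevM22, Lemma 11] -/
theorem false_of_sameClass_two (hm : 5 ≤ m) (hJ : F.J.card ≤ m + 2) {t1 t2 : ι} (h1 : t1 ∈ F.J)
    (h2 : t2 ∈ F.J) (hne : t1 ≠ t2) (hp1 : pvec β t1 ≠ 0) (hp2 : pvec β t2 ≠ 0)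
    (hpar : ∃ a : k, pvec β t2 = a • pvec β t1) : False := by
  classical
  obtain ⟨a12, ha12⟩ := hpar
  have ha12ne : a12 ≠ 0 := by rintro rfl; exact hp2 (by rw [ha12, zero_smul])
  -- the rows of the other classes
  let U : Submodule k (Matrix (Fin m) (Fin 2) k) :=
    Submodule.span k (Set.range fun j : {j : ↥F.I // ¬ ∃ a : k, pvec β j = a • pvec β t1} =>
      F.xd hI j.1)
  let Res : Blk k m →ₗ[k] (↥U →ₗ[k] (Fin 2 → k)) := LinearMap.lcomp k (Fin 2 → k) U.subtype
  have hRes : ∀ (N : Blk k m), (∀ j : ↥F.I, (¬ ∃ a : k, pvec β j = a • pvec β t1) →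
      N (F.xd hI j) = 0) → Res N = 0 := by
    intro N hN
    apply LinearMap.ext
    intro u
    have hU : U ≤ LinearMap.ker N := by
      refine Submodule.span_le.mpr ?_
      rintro _ ⟨j, rfl⟩
      exact hN j.1 j.2
    simpa [Res] using hU u.2
  have hR1 : Res (F.N2 t1) = 0 :=
    hRes _ fun j hj => by_contra fun hne0 => hj (F.par_of_N2_xd_ne_zero hI (F.mem_J.1 h1) hp1 j hne0)
  have hR2 : Res (F.N2 t2) = 0 := by
    refine hRes _ fun j hj => by_contra fun hne0 => hj ?_
    obtain ⟨a, ha⟩ := F.par_of_N2_xd_ne_zero hI (F.mem_J.1 h2) hp2 j hne0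
    exact ⟨a * a12, by rw [ha, ha12, smul_smul]⟩
  -- the restricted P_i lie in the span of the |J| - 2 restricted N's
  let K : Finset ι := F.J \ {t1, t2}
  have hsub : ({t1, t2} : Finset ι) ⊆ F.J := by
    intro t ht
    rcases Finset.mem_insert.1 ht with rfl | ht
    · exact h1
    · rwa [Finset.mem_singleton.1 ht]
  have hKcard : K.card = F.J.card - 2 := by
    rw [Finset.card_sdiff_of_subset hsub, Finset.card_pair hne]
  let SN : Submodule k (↥U →ₗ[k] (Fin 2 → k)) :=
    Submodule.span k (↑(K.image fun t => Res (F.N2 t)) : Set (↥U →ₗ[k] (Fin 2 → k)))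
  have hmem : ∀ i, Res (rowMap k m i) ∈ SN := by
    intro i
    rw [F.rowMap_eq_sum_N2 i, map_sum]
    refine Submodule.sum_mem _ fun t ht => ?_
    rw [map_smul]
    refine Submodule.smul_mem _ _ ?_
    by_cases hK : t ∈ K
    · exact Submodule.subset_span (by
        rw [Finset.coe_image]
        exact ⟨t, by simpa using hK, rfl⟩)
    · have hor : t = t1 ∨ t = t2 := by
        by_contra hh
        obtain ⟨h1', h2'⟩ := not_or.mp hh
        exact hK (Finset.mem_sdiff.2 ⟨ht, by simp [h1', h2']⟩)
      rcases hor with rfl | rfl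
      · rw [hR1]; exact Submodule.zero_mem _
      · rw [hR2]; exact Submodule.zero_mem _
  -- the restricted P_i are independent (Lemma 9)
  have hli : LinearIndependent k fun i => Res (rowMap k m i) := by
    rw [Fintype.linearIndependent_iff]
    intro c hc
    have hc' : Res (∑ i, c i • rowMap k m i) = 0 := by
      rw [map_sum]
      simpa [map_smul] using hc
    have hzero := F.eq_zero_of_vanish hI (pvec β t1) c fun j hj => by
      have hxU : F.xd hI j ∈ U := Submodule.subset_span ⟨⟨j, hj⟩, rfl⟩
      have := LinearMap.congr_fun hc' ⟨F.xd hI j, hxU⟩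
      simpa [Res] using this
    exact fun i => congrFun hzero i
  let SP : Submodule k (↥U →ₗ[k] (Fin 2 → k)) :=
    Submodule.span k (Set.range fun i => Res (rowMap k m i))
  have hdimP : finrank k SP = m := by
    simp only [SP]
    rw [finrank_span_eq_card hli, Fintype.card_fin]
  have hPN : SP ≤ SN := Submodule.span_le.mpr (by rintro _ ⟨i, rfl⟩; exact hmem i)
  have hdimN : finrank k SN ≤ K.card :=
    (finrank_span_finset_le_card (R := k) (K.image fun t => Res (F.N2 t))).trans
      Finset.card_image_le
  have hmono : finrank k SP ≤ finrank k SN := Submodule.finrank_mono hPN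
  have hKm : K.card = m := by omega
  -- the two spans coincide
  have hSPN : SP = SN := Submodule.eq_of_le_of_finrank_le hPN (by omega)
  -- every restricted N_t, t ∈ K, is non-zero
  have hRne : ∀ t ∈ K, Res (F.N2 t) ≠ 0 := by
    intro t ht h0
    have hle : SN ≤ Submodule.span k
        (↑((K.erase t).image fun t' => Res (F.N2 t')) : Set (↥U →ₗ[k] (Fin 2 → k))) := by
      refine Submodule.span_le.mpr ?_
      intro v hv
      rw [Finset.coe_image] at hv
      obtain ⟨t', ht', rfl⟩ := hv
      show Res (F.N2 t') ∈ _
      by_cases htt : t' = t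
      · rw [htt, h0]; exact Submodule.zero_mem _
      · refine Submodule.subset_span ?_
        rw [Finset.coe_image]
        exact ⟨t', Finset.mem_erase.2 ⟨htt, ht'⟩, rfl⟩
    have h3 := Submodule.finrank_mono hle
    have h4 : finrank k (Submodule.span k
        (↑((K.erase t).image fun t' => Res (F.N2 t')) : Set (↥U →ₗ[k] (Fin 2 → k)))) ≤
        (K.erase t).card :=
      (finrank_span_finset_le_card (R := k) ((K.erase t).image fun t' => Res (F.N2 t'))).trans
        Finset.card_image_le
    rw [Finset.card_erase_of_mem ht] at h4
    omega
  -- every N_t, t ∈ K, has rank one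
  have hKR1 : K ⊆ F.R1 := by
    intro t ht
    have htJ : t ∈ F.J := (Finset.mem_sdiff.1 ht).1
    have htI : t ∉ F.I := F.mem_J.1 htJ
    rw [F.mem_R1]
    refine ⟨htJ, ?_⟩
    by_cases hpt : pvec β t = 0
    · -- type F: `D_t^1 = 0`, `N_t = D_t` of rank one (Lemma 10)
      have hD : D1 β t = 0 := by ext x; simp [hpt]
      rw [F.N2_eq_D2_of_D1_eq_zero htI hD]
      exact rankLEOne_smulRight _ _
    · -- type G: the restricted N_t is a combination of the restricted P_i
      have hcomb : Res (F.N2 t) ∈ SP := by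
        rw [hSPN]
        refine Submodule.subset_span ?_
        rw [Finset.coe_image]
        exact ⟨t, by simpa using ht, rfl⟩
      obtain ⟨a, ha⟩ := (Submodule.mem_span_range_iff_exists_fun k).1 hcomb
      -- p_t is not in the class of p_{t₁} (otherwise the restricted N_t would vanish)
      have hnpar : ¬ ∃ c : k, pvec β t = c • pvec β t1 := by
        rintro ⟨c, hc⟩
        refine hRne t ht (hRes _ fun j hj => ?_)
        by_contra hne0
        obtain ⟨a', ha'⟩ := F.par_of_N2_xd_ne_zero hI htI hpt j hne0
        exact hj ⟨a' * c, by rw [ha', hc, smul_smul]⟩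
      -- all values N_t(x_j) lie on the line k p_t
      refine rankLEOne_of_forall_mem_span _ (pvec β t) (F.map_mem_of_xd_mem₂ hI _ _ fun j => ?_)
      by_cases hz : F.N2 t (F.xd hI j) = 0
      · rw [hz]; exact Submodule.zero_mem _
      · obtain ⟨a', ha'⟩ := F.par_of_N2_xd_ne_zero hI htI hpt j hz
        have ha'ne : a' ≠ 0 := by
          rintro rfl; exact F.pvec_ne_zero j.2 (by rw [ha', zero_smul])
        have hj : ¬ ∃ c : k, pvec β j = c • pvec β t1 := by
          rintro ⟨c, hc⟩
          exact hnpar ⟨a'⁻¹ * c, by rw [mul_smul, ← hc, ha', smul_smul, inv_mul_cancel₀ ha'ne, one_smul]⟩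
        have hxU : F.xd hI j ∈ U := Submodule.subset_span ⟨⟨j, hj⟩, rfl⟩
        have hval := LinearMap.congr_fun ha ⟨F.xd hI j, hxU⟩
        have hs := F.sum_rowMap_xd hI a j
        simp only [LinearMap.coe_sum, Finset.sum_apply, LinearMap.smul_apply] at hs
        simp only [Res, LinearMap.coe_sum, Finset.sum_apply, LinearMap.smul_apply,
          LinearMap.lcomp_apply', Submodule.subtype_apply, LinearMap.comp_apply] at hval
        rw [← hval, hs, ha', smul_smul]
        exact Submodule.smul_mem _ _ (Submodule.mem_span_singleton_self _)
  -- the column count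
  have hR1card : m ≤ F.R1.card := by
    have := Finset.card_le_card hKR1
    omega
  have hcol := F.colCount
  have hsd : (F.J \ F.R1).card = F.J.card - F.R1.card := Finset.card_sdiff_of_subset F.R1_subset
  have hR1le : F.R1.card ≤ F.J.card := Finset.card_le_card F.R1_subset
  omega

include hI in
/-- **Lemma 7 as printed: Problem `P` has no solution with parameters `(2m, m+2)` for `m ≥ 5`**
(here: no frame with `|I| = 2m` and `|J| ≤ m + 2`). The count of rank-one `N_t` gives `s ≤ 4`; since
`m − s ≥ 1` a non-zero `Q = ∑ c_i P_i` in the span of the rank-two `N_t` exists; writing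
`Q = ∑ λ_t N_t^2`, an index `t₀` with `λ_{t₀} ≠ 0` has all `N_{t₀}^2(x_j)` on the line `k p_{t₀}`
(the other rank-two `N_t` vanish on the class of `t₀` by Lemmas 10–11, and `Q(x_j) ∈ k p_j` by
Lemma 8), so `N_{t₀}^2` has rank one — a contradiction. [cite: Alekseev2015ChebyshevM22, Lemma 7] -/
theorem stepD_two (hm : 5 ≤ m) (hJ : F.J.card ≤ m + 2) : False := by
  classical
  -- s ≤ 4
  have hcol := F.colCount
  have hsd : (F.J \ F.R1).card = F.J.card - F.R1.card := Finset.card_sdiff_of_subset F.R1_subset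
  have hR1le : F.R1.card ≤ F.J.card := Finset.card_le_card F.R1_subset
  have hR1 : F.R1.card ≤ 4 := by omega
  -- the spaces
  let R2 : Finset ι := F.J \ F.R1
  let SS : Submodule k (Blk k m) := Submodule.span k (Set.range (rowMap k m))
  let C : Submodule k (Blk k m) := Submodule.span k (Set.range fun t : ↥R2 => F.N2 t)
  let B1 : Submodule k (Blk k m) := Submodule.span k (↑(F.R1.image F.N2) : Set (Blk k m))
  have hSS : finrank k SS = m := by
    simp only [SS]
    rw [finrank_span_eq_card (linearIndependent_rowMap (k := k) (m := m)), Fintype.card_fin]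
  have hB1 : finrank k B1 ≤ 4 :=
    ((finrank_span_finset_le_card (R := k) (F.R1.image F.N2)).trans Finset.card_image_le).trans hR1
  have hle : SS ≤ B1 ⊔ C := by
    refine Submodule.span_le.mpr ?_
    rintro _ ⟨i, rfl⟩
    rw [F.rowMap_eq_sum_N2 i]
    refine Submodule.sum_mem _ fun t ht => Submodule.smul_mem _ _ ?_
    by_cases hR : t ∈ F.R1
    · refine Submodule.mem_sup_left (Submodule.subset_span ?_)
      rw [Finset.coe_image]
      exact ⟨t, by simpa using hR, rfl⟩
    · refine Submodule.mem_sup_right (Submodule.subset_span ?_)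
      exact ⟨⟨t, Finset.mem_sdiff.2 ⟨ht, hR⟩⟩, rfl⟩
  have hdim : m ≤ finrank k ↥(SS ⊓ C) + 4 := by
    have h1 := Submodule.finrank_sup_add_finrank_inf_eq SS C
    have h2 : finrank k ↥(SS ⊔ C) ≤ finrank k ↥(B1 ⊔ C) :=
      Submodule.finrank_mono (sup_le hle le_sup_right)
    have h3 := Submodule.finrank_add_le_finrank_add_finrank B1 C
    omega
  have hne : SS ⊓ C ≠ ⊥ := by
    intro hbot
    rw [hbot, finrank_bot] at hdim
    omega
  obtain ⟨Q, hQmem, hQne⟩ := Submodule.exists_mem_ne_zero_of_ne_bot hne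
  obtain ⟨c, hc⟩ := (Submodule.mem_span_range_iff_exists_fun k).1 (Submodule.mem_inf.1 hQmem).1
  obtain ⟨lam, hlam⟩ := (Submodule.mem_span_range_iff_exists_fun k).1 (Submodule.mem_inf.1 hQmem).2
  -- a t0 with λ ≠ 0
  obtain ⟨t0, ht0⟩ : ∃ t0 : ↥R2, lam t0 ≠ 0 := by
    by_contra hall
    apply hQne
    rw [← hlam]
    refine Finset.sum_eq_zero fun t _ => ?_
    rw [show lam t = 0 from not_not.mp (fun h => hall ⟨t, h⟩), zero_smul]
  have hR2J : ∀ t : ↥R2, (t : ι) ∈ F.J := fun t => (Finset.mem_sdiff.1 t.2).1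
  have hR2I : ∀ t : ↥R2, (t : ι) ∉ F.I := fun t => F.mem_J.1 (hR2J t)
  have hR2R : ∀ t : ↥R2, (t : ι) ∉ F.R1 := fun t => (Finset.mem_sdiff.1 t.2).2
  have hR2p : ∀ t : ↥R2, pvec β t ≠ 0 := fun t => F.pvec_ne_zero_of_not_mem_R1 (hR2J t) (hR2R t)
  -- all values N2 t0 (x_j) lie on the line k p_{t0}
  have hlineJ : ∀ j : ↥F.I, F.N2 t0 (F.xd hI j) ∈
      Submodule.span k ({pvec β t0} : Set (Fin 2 → k)) := by
    intro j
    by_cases hpar : ∃ a : k, pvec β j = a • pvec β t0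
    · -- the other rank-two N_t vanish at x_j
      have hvan : ∀ t : ↥R2, t ≠ t0 → F.N2 t (F.xd hI j) = 0 := by
        intro t htne
        by_contra hne0
        obtain ⟨a, ha⟩ := F.par_of_N2_xd_ne_zero hI (hR2I t) (hR2p t) j hne0
        obtain ⟨a', ha'⟩ := hpar
        have hane : a ≠ 0 := by
          rintro rfl; exact F.pvec_ne_zero j.2 (by rw [ha, zero_smul])
        refine F.false_of_sameClass_two hI hm hJ (hR2J t0) (hR2J t)
          (fun h => htne (Subtype.ext h.symm)) (hR2p t0) (hR2p t) ⟨a⁻¹ * a', ?_⟩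
        rw [mul_smul, ← ha', ha, smul_smul, inv_mul_cancel₀ hane, one_smul]
      have hQj : Q (F.xd hI j) = lam t0 • F.N2 t0 (F.xd hI j) := by
        rw [← hlam, LinearMap.coe_sum, Finset.sum_apply, Finset.sum_eq_single t0]
        · rfl
        · intro t _ htne
          rw [LinearMap.smul_apply, hvan t htne, smul_zero]
        · simp
      have hQj' : Q (F.xd hI j) = (∑ i, c i * F.κ i j) • pvec β j := by
        rw [← hc, F.sum_rowMap_xd hI c j]
      obtain ⟨a', ha'⟩ := hpar
      have : F.N2 t0 (F.xd hI j) = ((lam t0)⁻¹ * ((∑ i, c i * F.κ i j) * a')) • pvec β t0 := by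
        rw [mul_smul, ← smul_smul, ← ha', ← hQj', hQj, smul_smul, inv_mul_cancel₀ ht0, one_smul]
      rw [this]
      exact Submodule.smul_mem _ _ (Submodule.mem_span_singleton_self _)
    · have : F.N2 t0 (F.xd hI j) = 0 := by
        by_contra hne0
        exact hpar (F.par_of_N2_xd_ne_zero hI (hR2I t0) (hR2p t0) j hne0)
      rw [this]
      exact Submodule.zero_mem _
  have hrk : RankLEOne (F.N2 t0) :=
    rankLEOne_of_forall_mem_span _ _ (F.map_mem_of_xd_mem₂ hI _ _ hlineJ)
  exact hR2R t0 (F.mem_R1.2 ⟨hR2J t0, hrk⟩)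

end StepDTwo

/-- **Lemma 6 with Lemma 7 (printed strength)**: a computation of length `≤ 3m + 2`, `m ≥ 5`, has
`l ≥ 2m + 1` (the parameters `(2m, m+2)`, `(2m, m+1)`, `(2m, m)` are impossible).
[cite: Alekseev2015ChebyshevM22, Lemma 6, Lemma 7, §4] -/
theorem two_mul_add_one_le_card_I (hm : 5 ≤ m) (hι : Fintype.card ι ≤ 3 * m + 2) :
    2 * m + 1 ≤ F.I.card := by
  have h1 := F.two_mul_le_card
  have h2 := F.le_card_J
  have h3 := F.card_I_add_card_J
  by_cases hI : F.I.card = 2 * m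
  · exact (F.stepD_two hI hm (by omega)).elim
  · omega

/-- **The parameters of a length-`3m + 2` solution, `m ≥ 5`** (Lemma 6: `l ≥ 2m`, `d − l ≥ m`;
Lemma 7: `l ≠ 2m`): `(l, d − l) = (2m+1, m+1)` or `(2m+2, m)`.
[cite: Alekseev2015ChebyshevM22, §4 (p. 24)] -/
theorem params_of_card_eq (hm : 5 ≤ m) (hι : Fintype.card ι = 3 * m + 2) :
    (F.I.card = 2 * m + 1 ∧ F.J.card = m + 1) ∨ (F.I.card = 2 * m + 2 ∧ F.J.card = m) := by
  have h1 := F.two_mul_add_one_le_card_I hm hι.le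
  have h2 := F.le_card_J
  have h3 := F.card_I_add_card_J
  omega

end Frame

/-- **Alekseev 2015, §4, for the open cell `17 ≤ R(⟨5,2,2⟩) = R(⟨2,2,5⟩) ≤ 18`**: over every field,
a bilinear computation of length `17` for `⟨5,2,2⟩` (`x ∈ k^{5×2}`, `y ∈ k^{2×2}`) has, for EVERY
frame (maximal independent subfamily of the first blocks `D_t^1 = f_t ⊗ p_t`), parameters
`(l, d − l) = (11, 6)` or `(12, 5)` — «решение сложности 17 может существовать только с параметрами
(10,7), (11,6) или (12,5) … лемма 7 показывает, что первый случай невозможен».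
[cite: Alekseev2015ChebyshevM22, §4 (p. 24)] -/
theorem params_522_of_length_17 (β : BilinComp (mulBilin k 5 2 2) (Fin 17)) (F : Frame β) :
    (F.I.card = 11 ∧ F.J.card = 6) ∨ (F.I.card = 12 ∧ F.J.card = 5) := by
  have h := F.params_of_card_eq (m := 5) le_rfl (by simp)
  omega

/-- The same for any index type of cardinality `17`. [cite: Alekseev2015ChebyshevM22, §4 (p. 24)] -/
theorem params_522_of_card_eq_17 [DecidableEq ι] (β : BilinComp (mulBilin k 5 2 2) ι)
    (hι : Fintype.card ι = 17) (F : Frame β) :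
    (F.I.card = 11 ∧ F.J.card = 6) ∨ (F.I.card = 12 ∧ F.J.card = 5) := by
  have h := F.params_of_card_eq (m := 5) le_rfl (by rw [hι])
  omega

end Alekseev2015

end Literature.Computability.AlgebraicComplexity
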